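import Literature.AnabelianGeometry.SemiGraphs.GraphOfAnabelioids
import Literature.AnabelianGeometry.Anabelioids.ProSigmaRestrict

/-!
# The pro-`Σ` completion of a semi-graph of anabelioids ([SemiAnbd] Definition 2.9 (ii), p. 31)

Mochizuki, *Semi-graphs of anabelioids*, Publ. RIMS **42** (2006) 221–322, §2, Definition 2.9 (ii),
author's manuscript p. 31 [cite: MochizukiSemiAnbd2006, Def. 2.9(ii) p.31], second sentence: "given a
semi-graph of anabelioids, we shall refer to as the *pro-`Σ` completion* of the given semi-graph of
anabelioids the semi-graph of anabelioids obtained by replacing each constituent anabelioid by its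
pro-`Σ` completion" (used in Example 2.10 for the semi-graphs of anabelioids of pointed stable curves,
and throughout [IUTchI] §2 for semi-graphs of anabelioids "of pro-`Σ` PSC-type").

This file (abc-iut cell, layer L3; the typing-inventory completion of the Def. 2.9 (ii) node, whose
one-anabelioid half is `Anabelioids/ProSigma.lean`) CONSTRUCTS that semi-graph of anabelioids over the
tree's `SemiGraphOfAnabelioids` (`GraphOfAnabelioids.lean`):

* `SemiGraphOfAnabelioids.proSigmaCompletion 𝒢 Σ` — same underlying semi-graph, constituents
  `ProSigmaCompletion (𝒢_v) Σ` / `ProSigmaCompletion (𝒢_e) Σ` (Galois categories by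
  `proSigmaCompletion_galoisCategory_holds`), gluing morphisms `b_*` restricted to the completions
  (`Anabelioids.Hom.proSigmaRestrict`, `ProSigmaRestrict.lean`);
* `SemiGraphOfAnabelioids.toProSigmaCompletion 𝒢 Σ : Hom 𝒢 (𝒢.proSigmaCompletion Σ)` — the
  comparison morphism over the identity of the underlying semi-graph, whose constituent morphisms
  `𝒢_c → 𝒢_c^Σ` are the inclusions of the full subcategories (the 2-cells `φ_b` are identities:
  restriction commutes with the inclusions on the nose).

Deliberately NOT here: any statement that the completion of a specific `𝒢` (e.g. of PSC-type) is
quasi-coherent / totally elevated / …, and the relation between `Π_{𝒢^Σ}` and the maximal pro-`Σ`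
quotient of `Π_𝒢` (they differ in general: finite graph-coverings of `𝔾` survive in `B(𝒢^Σ)`).
-/

namespace Literature.AnabelianGeometry.SemiGraphs

open CategoryTheory Literature.AnabelianGeometry.Anabelioids

universe v₁ u₁ u

namespace SemiGraphOfAnabelioids

variable (𝒢 : SemiGraphOfAnabelioids.{v₁, u₁, u}) (Sigma : Set ℕ)

-- justification: as for `SemiGraphOfAnabelioids` itself (`GraphOfAnabelioids.lean`), the object and
-- morphism universes of the constituent categories occur only together.
set_option linter.checkUnivs false in
/-- **The pro-`Σ` completion of a semi-graph of anabelioids** ([SemiAnbd] Def. 2.9 (ii)): "the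
semi-graph of anabelioids obtained by replacing each constituent anabelioid by its pro-`Σ`
completion" — same underlying semi-graph; `(𝒢^Σ)_v := (𝒢_v)^Σ`, `(𝒢^Σ)_e := (𝒢_e)^Σ` (full
subcategories of `Σ`-dominated objects, Galois categories by `proSigmaCompletion_galoisCategory_holds`);
`b_*` restricted to the completions. [cite: MochizukiSemiAnbd2006, Def. 2.9(ii) p.31] -/
noncomputable def proSigmaCompletion : SemiGraphOfAnabelioids.{v₁, u₁, u} where
  graph := 𝒢.graph
  V v := ProSigmaCompletion (𝒢.V v) Sigma
  E e := ProSigmaCompletion (𝒢.E e) Sigma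
  galV v := proSigmaCompletion_galoisCategory_holds (𝒢.V v) Sigma
  galE e := proSigmaCompletion_galoisCategory_holds (𝒢.E e) Sigma
  pull b v h := (𝒢.pull b v h).proSigmaRestrict Sigma

/-- The underlying semi-graph of the pro-`Σ` completion is that of `𝒢`.
[cite: MochizukiSemiAnbd2006, Def. 2.9(ii) p.31] -/
@[simp] theorem proSigmaCompletion_graph : (𝒢.proSigmaCompletion Sigma).graph = 𝒢.graph := rfl

/-- The vertex constituents of the completion are the completions of the vertex constituents.
[cite: MochizukiSemiAnbd2006, Def. 2.9(ii) p.31] -/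
theorem proSigmaCompletion_V (v : 𝒢.graph.Vertex) :
    (𝒢.proSigmaCompletion Sigma).V v = ProSigmaCompletion (𝒢.V v) Sigma := rfl

/-- The edge constituents of the completion are the completions of the edge constituents.
[cite: MochizukiSemiAnbd2006, Def. 2.9(ii) p.31] -/
theorem proSigmaCompletion_E (e : 𝒢.graph.Edge) :
    (𝒢.proSigmaCompletion Sigma).E e = ProSigmaCompletion (𝒢.E e) Sigma := rfl

/-- The gluing functors of the completion are the restricted gluing functors: on underlying objects,
`(b_*^Σ)^* S = b^* S`. [cite: MochizukiSemiAnbd2006, Def. 2.9(ii) p.31] -/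
theorem proSigmaCompletion_pull_obj (b : 𝒢.graph.Branch) (v : 𝒢.graph.Vertex)
    (h : 𝒢.graph.abuts b = some v) (S : ProSigmaCompletion (𝒢.V v) Sigma) :
    (((𝒢.proSigmaCompletion Sigma).pull b v h).pullback.obj S).obj =
      (𝒢.pull b v h).pullback.obj S.obj := rfl

/-- The edge component of the comparison morphism `𝒢 → 𝒢^Σ` over an equality of edges
(bookkeeping for the indexing of `Hom.φE`). [cite: MochizukiSemiAnbd2006, Def. 2.9(ii) p.31] -/
noncomputable def toProSigmaCompletionE (e f : 𝒢.graph.Edge) (h : e = f) :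
    Anabelioids.Hom (𝒢.E e) ((𝒢.proSigmaCompletion Sigma).E f) :=
  h ▸ Anabelioids.Hom.toProSigma (𝒢.E e) Sigma

/-- **The comparison morphism `𝒢 → 𝒢^Σ`** to the pro-`Σ` completion: the identity on the underlying
semi-graph, the morphisms of anabelioids `𝒢_c → (𝒢_c)^Σ` given by the (exact) inclusions of the
completions, and identity 2-cells (`ι_v ⋙ b^* = (b^Σ)^* ⋙ ι_e` on the nose).
[cite: MochizukiSemiAnbd2006, Def. 2.9(ii) p.31] -/
noncomputable def toProSigmaCompletion : Hom 𝒢 (𝒢.proSigmaCompletion Sigma) where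
  base := 𝟙 𝒢.graph
  φV v := Anabelioids.Hom.toProSigma (𝒢.V v) Sigma
  φE e f h := 𝒢.toProSigmaCompletionE Sigma e f h
  φB _ _ _ := Iso.refl _

/-- The comparison morphism lies over the identity of the underlying semi-graph.
[cite: MochizukiSemiAnbd2006, Def. 2.9(ii) p.31] -/
@[simp] theorem toProSigmaCompletion_base : (𝒢.toProSigmaCompletion Sigma).base = 𝟙 𝒢.graph := rfl

/-- The vertex components of the comparison morphism pull back along the inclusion
`(𝒢_v)^Σ ⥤ 𝒢_v`. [cite: MochizukiSemiAnbd2006, Def. 2.9(ii) p.31] -/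
theorem toProSigmaCompletion_φV_pullback (v : 𝒢.graph.Vertex) :
    ((𝒢.toProSigmaCompletion Sigma).φV v).pullback = (proSigmaObj (A := 𝒢.V v) Sigma).ι := rfl

end SemiGraphOfAnabelioids

end Literature.AnabelianGeometry.SemiGraphs
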